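import Literature.AlgebraicGeometry.Morphisms.RelativelyVeryAmpleOfFibreSections
import Literature.AlgebraicGeometry.Morphisms.ProjectiveMorphismComposition
import HarnessLib

/-!
# Fibrewise very ample ⇒ H-projective over an affine neighbourhood (bridge from EGA III 4.7.1 to `IsProjective`)

Topic `AlgebraicGeometry/Morphisms`; namespace `Literature.AlgebraicGeometry.Morphisms`. THEOREMS ONLY (no definition, no named
fact, no instance, no `sorry`).

★ `Morphisms/RelativelyVeryAmpleOfFibreSections` (EGA III 4.7.1 in the tree's currencies) concludes with a CLOSED IMMERSION
`X_g ×_{A_g} (A_g)_r ↪ ℙⁿ_{(A_g)_r} = Proj (A_g)_r[x₀,…,xₙ]` over `Spec (A_g)_r` defined by generating sections. This file turns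
such a conclusion into the morphism-class statement the F-2 consumers import (★ `Morphisms/ProjectiveMorphism.IsProjective`,
Hartshorne's projective / Stacks' H-projective morphisms; stable under base change and composition by
★ `Morphisms/ProjectiveMorphismComposition`):

* `IsProjective.of_isClosedImmersion_toSpec` — a closed immersion `Y ↪ Proj R[x₀,…,x_m]` over `Spec R` (`m = #ι`) makes
  `Y → Spec R` projective (ring-level analogue of ★ `IsProjective.of_hom_projectiveSpace`, through
  ★ `isPullback_projToSpec_projMap_terminal : Proj R[x] ≅ 𝐏(ι; Spec R)`); `IsProjective.of_isClosedImmersion_proj` — the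
  `Fin (n + 1)` form; `IsProjective.of_generatingSections` — for the morphism `D.toProj f` of generating-sections data;
* **`exists_isProjective_away_of_ofCocycleSections`**, **`exists_isProjective_away_of_frameSystem`** — under the hypotheses
  of ★ `exists_isClosedImmersion_toProj_ofCocycleSections_away` / `…_ofFrameSystem_away` (proper `X → Spec A`, sections of a
  line bundle generating along the fibre over `𝔭` and embedding it into `ℙⁿ_{κ(𝔭)}`): for some `g ∉ 𝔭` and `r ∈ A_g` outside
  `𝔭A_g`, **`X_g ×_{A_g} (A_g)_r → Spec (A_g)_r` IS PROJECTIVE** (hence proper and separated, ★ `IsProjective.isProper`).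

Cell `hodgecm-mathlib`, (h2→h10) bridge named by B-plan1 (g15) 04:54Z. Count-neutral (HC_CM is proved only modulo the 7 printed
citations until rung 0 closes).

## References
* A. Grothendieck, J. Dieudonné, *EGA III₁* (1961), Thm. 4.7.1. [EGAIII1]
* R. Hartshorne, *Algebraic Geometry* (1977), II §4, Definition p. 103 (projective morphism); II Thm. 7.1. [Hartshorne1977]
-/

universe v u

open CategoryTheory CategoryTheory.Limits AlgebraicGeometry TopologicalSpace
open Literature.AlgebraicGeometry.Motives Literature.AlgebraicGeometry.Motives.Segre
open Literature.AlgebraicGeometry.Motives.GeneratingSections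

namespace Literature.AlgebraicGeometry.Morphisms

attribute [local instance] MvPolynomial.gradedAlgebra

/-! ### Closed immersions into `Proj R[x₀,…,xₙ]` over `Spec R` are projective morphisms -/

section OfProj

variable {R : Type u} [CommRing R] {Y : Scheme.{u}}

-- Mathlib's pull-back API is stated over `limit` abbrevs; as in ★ `ProjectiveMorphismComposition` we let unification see
-- through them for this one declaration.
set_option backward.isDefEq.respectTransparency false in
/-- **A closed immersion into `Proj R[x₀,…,x_m]` over `Spec R` makes `Y → Spec R` projective** (`m = #ι`; Hartshorne's
definition, through `Proj R[x] ≅ 𝐏(ι; Spec R) = Spec R ×_ℤ 𝐏_ℤ`, ★ `isPullback_projToSpec_projMap_terminal`).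
[cite: Hartshorne1977, II §4 Definition p.103 (projective morphism)] -/
theorem IsProjective.of_isClosedImmersion_toSpec (ι : Type u) [Finite ι] {m : ℕ} (hm : Nat.card ι = m)
    (φ : Y ⟶ Proj (Segre.grading (Fin (m + 1)) R)) [IsClosedImmersion φ] (f : Y ⟶ Spec (.of R))
    (hφ : φ ≫ toSpec (Fin (m + 1)) R = f) : IsProjective f := by
  subst hm
  letI : Algebra intU.{u} R := ULift.algebra' ..
  refine ⟨ι, ‹_›, φ ≫ (isPullback_projToSpec_projMap_terminal ι R).isoPullback.hom, inferInstance, ?_⟩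
  rw [Category.assoc, projectiveSpaceSpec_isoPullback_hom_fst, ← hφ]
  rfl

/-- The `Fin (n + 1)` form: a closed immersion `Y ↪ Proj R[x₀,…,xₙ]` over `Spec R` makes `Y → Spec R` projective.
[cite: Hartshorne1977, II §4 Definition p.103 (projective morphism)] -/
theorem IsProjective.of_isClosedImmersion_proj {n : ℕ} (φ : Y ⟶ Proj (Segre.grading (Fin (n + 1)) R)) [IsClosedImmersion φ]
    (f : Y ⟶ Spec (.of R)) (hφ : φ ≫ toSpec (Fin (n + 1)) R = f) : IsProjective f :=
  IsProjective.of_isClosedImmersion_toSpec (ULift.{u} (Fin n)) (by rw [Nat.card_ulift, Nat.card_fin]) φ f hφ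

/-- **Generating sections whose morphism to `ℙⁿ_R` is a closed immersion make `Y → Spec R` projective** (`D.toProj f` is over
`Spec R`, ★ `GeneratingSections.toProj_toSpec`). [cite: Hartshorne1977, II Thm. 7.1] -/
theorem IsProjective.of_generatingSections {n : ℕ} (f : Y ⟶ Spec (.of R)) (D : GeneratingSections (Fin (n + 1)) Y)
    (hD : IsClosedImmersion (D.toProj f)) : IsProjective f :=
  haveI := hD
  IsProjective.of_isClosedImmersion_proj (D.toProj f) f (D.toProj_toSpec f)

end OfProj

/-! ### Fibrewise very ample ⇒ projective over an affine neighbourhood -/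

section Away

variable {A : Type u} [CommRing A] {n : ℕ} {X : Scheme.{u}} (f : X ⟶ Spec (.of A)) [IsProper f] (𝔭 : PrimeSpectrum A)
  {X₀ : Scheme.{u}} {iX : X₀ ⟶ X} {f₀ : X₀ ⟶ Spec (.of 𝔭.asIdeal.ResidueField)}
  (HX : IsPullback iX f₀ f (Spec.map (CommRingCat.ofHom (algebraMap A 𝔭.asIdeal.ResidueField))))

include HX

/-- **EGA III 4.7.1 ⇒ H-projective over a neighbourhood (coefficient form).** `f : X → Spec A` proper; `S` = `n + 1` sections of a
line bundle trivialised on the `W a`, generating along `f⁻¹(𝔭)` and embedding the fibre `X₀ = X ×_A κ(𝔭)` into `ℙⁿ_{κ(𝔭)}`. Then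
for some `g ∉ 𝔭`, the prime `𝔭₁ = 𝔭A_g` and some `r ∉ 𝔭₁`, the morphism `X_g ×_{A_g} (A_g)_r → Spec (A_g)_r` is PROJECTIVE
(Hartshorne / H-projective, ★ `IsProjective`). [cite: EGAIII1, Thm. 4.7.1] -/
theorem exists_isProjective_away_of_ofCocycleSections {α : Type v} {W : α → X.Opens} (S : CocycleSections (Fin (n + 1)) W)
    (hgen : ∀ x : X, f x = 𝔭 → x ∈ ⨆ i, ⨆ a, X.basicOpen (S.coeff i a))
    (hcov₀ : ⨆ i, ⨆ a, X₀.basicOpen ((S.comap iX).coeff i a) = ⊤)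
    (H : IsClosedImmersion ((ofCocycleSections (fun a => iX ⁻¹ᵁ W a) (S.comap iX) hcov₀).toProj f₀)) :
    ∃ (g : A), g ∉ 𝔭.asIdeal ∧
      ∃ 𝔭₁ : PrimeSpectrum (Localization.Away g), PrimeSpectrum.comap (algebraMap A (Localization.Away g)) 𝔭₁ = 𝔭 ∧
      ∃ r : Localization.Away g, r ∉ 𝔭₁.asIdeal ∧ IsProjective
        (pullback.snd (pullback.snd f (Spec.map (CommRingCat.ofHom (algebraMap A (Localization.Away g)))))
          (Spec.map (CommRingCat.ofHom (algebraMap (Localization.Away g) (Localization.Away r))))) := by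
  obtain ⟨g, hg, hcovg, 𝔭₁, h𝔭₁, r, hr, hci⟩ :=
    exists_isClosedImmersion_toProj_ofCocycleSections_away f S 𝔭 HX hgen hcov₀ H
  exact ⟨g, hg, 𝔭₁, h𝔭₁, r, hr, IsProjective.of_generatingSections _ _ hci⟩

/-- **EGA III 4.7.1 ⇒ H-projective over a neighbourhood (line-bundle form).** `f : X → Spec A` proper; `E : X.Modules` with a
rank-one frame system `F` and global sections `t₀,…,tₙ` generating along `f⁻¹(𝔭)` (★ `coeffAt`) and embedding the fibre into
`ℙⁿ_{κ(𝔭)}`. Then `X_g ×_{A_g} (A_g)_r → Spec (A_g)_r` is PROJECTIVE for some `g ∉ 𝔭`, `r ∉ 𝔭A_g`. [cite: EGAIII1, Thm. 4.7.1] -/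
theorem exists_isProjective_away_of_frameSystem {E : X.Modules} (F : Modules.FrameSystem E) (h1 : ∀ x, F.rank x = 1)
    (t : Fin (n + 1) → Γ(E, ⊤))
    (hgen : ∀ x : X, f x = 𝔭 → ∃ i, x ∈ X.basicOpen (coeffAt F h1 t i x))
    (hcov₀ : ⨆ i, ⨆ a, X₀.basicOpen (((CocycleSections.ofFrameSystem F h1 t).comap iX).coeff i a) = ⊤)
    (H : IsClosedImmersion
      ((ofCocycleSections (fun a => iX ⁻¹ᵁ F.U a) ((CocycleSections.ofFrameSystem F h1 t).comap iX) hcov₀).toProj f₀)) :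
    ∃ (g : A), g ∉ 𝔭.asIdeal ∧
      ∃ 𝔭₁ : PrimeSpectrum (Localization.Away g), PrimeSpectrum.comap (algebraMap A (Localization.Away g)) 𝔭₁ = 𝔭 ∧
      ∃ r : Localization.Away g, r ∉ 𝔭₁.asIdeal ∧ IsProjective
        (pullback.snd (pullback.snd f (Spec.map (CommRingCat.ofHom (algebraMap A (Localization.Away g)))))
          (Spec.map (CommRingCat.ofHom (algebraMap (Localization.Away g) (Localization.Away r))))) := by
  obtain ⟨g, hg, hcovg, 𝔭₁, h𝔭₁, r, hr, hci⟩ :=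
    exists_isClosedImmersion_toProj_ofFrameSystem_away f F h1 t 𝔭 HX hgen hcov₀ H
  exact ⟨g, hg, 𝔭₁, h𝔭₁, r, hr, IsProjective.of_generatingSections _ _ hci⟩

/-- The projective neighbourhood morphism is in particular PROPER and SEPARATED (★ `IsProjective.isProper`). [cite: EGAIII1, Thm. 4.7.1] -/
theorem exists_isProper_away_of_frameSystem {E : X.Modules} (F : Modules.FrameSystem E) (h1 : ∀ x, F.rank x = 1)
    (t : Fin (n + 1) → Γ(E, ⊤))
    (hgen : ∀ x : X, f x = 𝔭 → ∃ i, x ∈ X.basicOpen (coeffAt F h1 t i x))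
    (hcov₀ : ⨆ i, ⨆ a, X₀.basicOpen (((CocycleSections.ofFrameSystem F h1 t).comap iX).coeff i a) = ⊤)
    (H : IsClosedImmersion
      ((ofCocycleSections (fun a => iX ⁻¹ᵁ F.U a) ((CocycleSections.ofFrameSystem F h1 t).comap iX) hcov₀).toProj f₀)) :
    ∃ (g : A), g ∉ 𝔭.asIdeal ∧
      ∃ 𝔭₁ : PrimeSpectrum (Localization.Away g), PrimeSpectrum.comap (algebraMap A (Localization.Away g)) 𝔭₁ = 𝔭 ∧
      ∃ r : Localization.Away g, r ∉ 𝔭₁.asIdeal ∧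
        IsProjective (pullback.snd (pullback.snd f (Spec.map (CommRingCat.ofHom (algebraMap A (Localization.Away g)))))
          (Spec.map (CommRingCat.ofHom (algebraMap (Localization.Away g) (Localization.Away r))))) ∧
        IsProper (pullback.snd (pullback.snd f (Spec.map (CommRingCat.ofHom (algebraMap A (Localization.Away g)))))
          (Spec.map (CommRingCat.ofHom (algebraMap (Localization.Away g) (Localization.Away r))))) := by
  obtain ⟨g, hg, 𝔭₁, h𝔭₁, r, hr, hP⟩ := exists_isProjective_away_of_frameSystem f 𝔭 HX F h1 t hgen hcov₀ H
  exact ⟨g, hg, 𝔭₁, h𝔭₁, r, hr, hP, hP.isProper⟩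

end Away

end Literature.AlgebraicGeometry.Morphisms
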